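import Summits.QuantumFields.YangMills.Theorems.IR.AfPincerUcXCovSharp
import Summits.QuantumFields.YangMills.Theorems.BalabanLadderNTReferenceTransfer
import Summits.QuantumFields.YangMills.Theorems.LangevinControlUVOSLegsFromFemtoAndGapStubLowerCube

/-!
# Crux `IR` (stmt-QuantumFields-19354), line `af-pincer`, X-side (lane (1)A): the asymptotic-freedom WINDOW
# from the FEMTO CONDITIONAL package — volume-free, exterior-uniform cube-kernel hypotheses

Seat ym-19354-afpincer-s2 (generation 3); slot of record «sharp merge I♯_SC» (owner R104, sha16 28967a1bf60ad397; stubs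
`stub_onsetSharpSC : SharpOnset.OnsetSharpUKPcSC` [LEAD], `stub_irNSC` [residual]).  Generation 2 reduced the whole X-side to two
TORUS covariance statements about the action density `A_x = dens G r x` (`Theorems/IR/AfPincerUcXCov{,Compact,Pincer,Sharp}`):
the WINDOW at the LEAD's scale `ℓ` («`(1+‖x−y‖)⁸ |Cov_{β,L}(A_x,A_y)| ≤ W` for `T′(W)‖x−y‖ ≤ ℓ(β)`, eventually in `L`») and the
crossover ENVELOPE; the LEAD's lane memo (LANES-R104) books the WINDOW as a UV-desk statement for which «the UV leg's present currency
has NO plaquette-covariance node».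

THIS FILE supplies the WINDOW at the scale `ℓ = 1/u` from hypotheses in the currency the UV engine is EXPECTED to speak — the
FEMTO CONDITIONAL currency of the line `dlr-collar-transfer` (`Theorems/LangevinControlUVOSLegsFromFemtoAndGapDefs`: cube kernels
`kerE`/`kerCov` of the tree specification `ymSpecification` on cubes `cubeEdges c b` with FROZEN exterior, `depth`) and of the `NT`
desk's engine items (E1-osc, collar form of `Theorems/BalabanLadderNTReferenceTorusCollar`), for a positive map `u` (the UV unit):

* (E1-osc, collar form VERBATIM from the `NT` desk with `a ↦ u`) the cube-kernel MEAN of `A_x` oscillates over exteriors by at most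
  `C₁ / depth⁴` at sites of physical depth `≥ κ` (`κ / u β ≤ depth`) of femto cubes (`b · u β ≤ ℓ`);
* (CondCovAF — conditional asymptotic freedom of the two-point amplitude) for every `W′ > 0` there are `s′ > 0, β′` such that on femto
  cubes, for EVERY exterior, at sites of physical depth `≥ κ` and lattice separation `≥ n₀`, physical separation `≤ s′`:
  `‖y−x‖⁸ · |kerCov^η(A_x, A_y)| ≤ W′` — the dimensionless CONDITIONAL two-point amplitude of `tr F²` is small at small physical
  separation, uniformly in the boundary condition (physically `≍ g(σ)⁴ + g(σ)²·(background)/κ⁴ → 0` as `σ → 0⁺`; it is implied by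
  the upper half of `DlrCollarTransfer.FC2 G r u` together with `Γ(0⁺) = 0`, taking `s₀ = ‖y−x‖·uβ` once `s K(s) ≤ κ`).

Main result **`covWindow_of_femtoAF`**: (E1-osc) ∧ (CondCovAF) in unit `u` ⇒ the WINDOW (generation 2's hypothesis `haf`, body verbatim)
at `ℓ β = 1 / u β`, on every torus `2L+1` large enough (stated `∀ᶠ L`).  NO large-volume input: the torus enters only through the exact
DLR equation.  Mechanism (per pair, `femto_pair_bound`): the two-sided law of total covariance through ONE cube around the pair (the `NT` desk's
`Reference.abs_torusCov_sub_torusE_kerCov_le`, p498266 lineage: `|Cov_L − E_L[kerCov^{lift}]| ≤ h_x h_y`), the cube of radius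
`R = ⌈κ/uβ⌉ + ⌈‖x−y‖⌉ + 1` around `x` (both sites at depth `≥ κ/uβ`, femto since `‖x−y‖·uβ ≤ 1/T′`), E1-osc twice (`h ≤ C₁ (uβ/κ)⁴`, and
`(uβ (1+‖x−y‖)/κ)⁸ ≤ (2/(T′κ))⁸` is small for `T′` large) and CondCovAF once; pairs closer than `max n₀ 1` are free by the tree's
volume-uniform weak-coupling bound `|Cov| ≤ W₁(1+log β)²/β²` (`AfOnset.exists_abs_torusCov_dens_le`, generation 0).

Corollaries BY NAME are in the sequel `Theorems/IR/AfPincerUcXCovFemtoSharp` (`AFBelowScaleAt` at `ℓ = 1/u`, with and without envelope;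
`SharpOnset.OnsetSharpUKPcSC` = the registered `stub_onsetSharpSC` type; `Theses.BalabanLadder.IR` through the residual).  So lane (1)A's
UV-side input may be delivered EITHER as a torus covariance node OR as the femto conditional package — the currency `Statement.stub_fcp` of
line `dlr-collar-transfer` already posits.

presearch: «conditional (frozen-boundary) two-point bound for tr F² at weak coupling, uniformly in the exterior» → none in print for compact
simple `G` (corpus hybrid/vsearch: Rivasseau 1991, Montvay–Münster 1994, Greensite 2011 — perturbative/numerical only; galaxy: noise); the DLR /
total-covariance mechanism is folklore (Georgii 2011 Thm. 4.17) and already kernel-checked in the tree.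

HONEST FRAMING.  A kernel REDUCTION: both hypotheses are OPEN research statements about 4-d non-abelian lattice gauge theory at weak coupling
(background-field asymptotic freedom of the `tr F²` two-point function, exterior-uniform boundary law); nothing here proves asymptotic freedom,
mixing or a gap; one open gap-crux of a CONDITIONAL chain (Track A 0/28 UV); not Clay.  No `sorry`; axioms ⊆ {propext, Classical.choice, Quot.sound}.
-/

set_option autoImplicit false

noncomputable section

open Filter Topology Finset MeasureTheory
open scoped BigOperators SchwartzMap
open Literature.MathematicalPhysics.QuantumFieldTheory hiding ZdEdge
open Literature.MathematicalPhysics.QuantumLattice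
open Literature.Probability.LatticeModels (Site box mem_box)
open Summit.QuantumFields.YangMills.Cruxes.OSLegsFromFemtoAndGap.DlrCollarTransfer
open Summit.QuantumFields.YangMills.Theorems.OSLegsFromFemtoAndGap (mul_norm_le_norm_smul_siteToE)
open Summit.QuantumFields.YangMills.Cruxes.IR.AfOnset

namespace Summit.QuantumFields.YangMills.Cruxes.IR.AfPincerUc

variable {G : Type} [Group G] [TopologicalSpace G] [IsTopologicalGroup G] [CompactSpace G]
  [MeasurableSpace G] [BorelSpace G]

/-! ## §1 Lattice norms: the window's sup-distance `‖x − y‖` against the engine's Euclidean `‖siteToE (y − x)‖` -/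
section Norms

omit [Group G] [TopologicalSpace G] [IsTopologicalGroup G] [CompactSpace G] [MeasurableSpace G] [BorelSpace G] in
/-- A coordinate of `y − x` is at most the sup-distance `‖x − y‖`. [folklore] -/
theorem abs_cast_sub_le_norm_sub (x y : Site 4) (j : Fin 4) :
    |((y j : ℤ) : ℝ) - x j| ≤ ‖x - y‖ := by
  have h : ‖(x - y) j‖ ≤ ‖x - y‖ := norm_le_pi_norm (x - y) j
  rw [Pi.sub_apply, Int.norm_eq_abs, Int.cast_sub] at h
  rwa [abs_sub_comm] at h

omit [Group G] [TopologicalSpace G] [IsTopologicalGroup G] [CompactSpace G] [MeasurableSpace G] [BorelSpace G] in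
/-- The sup-distance is at most the Euclidean distance: `‖x − y‖ ≤ ‖siteToE (y − x)‖`. [folklore] -/
theorem norm_sub_le_norm_siteToE_sub (x y : Site 4) : ‖x - y‖ ≤ ‖siteToE (y - x)‖ := by
  have h := mul_norm_le_norm_smul_siteToE (le_of_lt one_pos) (y - x)
  rw [one_mul, one_smul, norm_sub_rev] at h
  exact h

omit [Group G] [TopologicalSpace G] [IsTopologicalGroup G] [CompactSpace G] [MeasurableSpace G] [BorelSpace G] in
/-- The Euclidean distance is at most twice the sup-distance (four coordinates): `‖siteToE (y − x)‖ ≤ 2‖x − y‖`. [folklore] -/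
theorem norm_siteToE_sub_le_two_mul_norm_sub (x y : Site 4) : ‖siteToE (y - x)‖ ≤ 2 * ‖x - y‖ := by
  rw [EuclideanSpace.norm_eq]
  have h0 : 0 ≤ ‖x - y‖ := norm_nonneg _
  have h : ∑ i, ‖(siteToE (y - x)).ofLp i‖ ^ 2 ≤ (2 * ‖x - y‖) ^ 2 := by
    calc ∑ i : Fin 4, ‖(siteToE (y - x)).ofLp i‖ ^ 2 ≤ ∑ _i : Fin 4, ‖x - y‖ ^ 2 :=
          Finset.sum_le_sum fun i _ => by
            rw [show (siteToE (y - x)).ofLp i = (((y - x) i : ℤ) : ℝ) from rfl, Real.norm_eq_abs]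
            refine pow_le_pow_left₀ (abs_nonneg _) ?_ 2
            have := abs_cast_sub_le_norm_sub x y i
            rwa [Pi.sub_apply, Int.cast_sub]
      _ = (2 * ‖x - y‖) ^ 2 := by simp; ring
  calc √(∑ i, ‖(siteToE (y - x)).ofLp i‖ ^ 2) ≤ √((2 * ‖x - y‖) ^ 2) := Real.sqrt_le_sqrt h
    _ = 2 * ‖x - y‖ := Real.sqrt_sq (by positivity)

end Norms

/-! ## §2 The per-pair bound: law of total covariance through ONE cube around the pair -/
section Pair

/-- **Per-pair femto bound (two-sided law of total covariance through the cube of radius `R` around `x`).**  On a torus of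
half-side `L ≥ R + 2`, for sites `x, y` with `|y − x|_∞ + 1 ≤ R`: if the cube-kernel means of `A_x`, `A_y` oscillate over
exteriors by at most `h_x`, `h_y` and the cube-kernel covariance of `A_x, A_y` is at most `V` in absolute value for EVERY exterior,
then `|Cov_{β,L}(A_x, A_y)| ≤ V + h_x h_y` (`NT.Reference.abs_torusCov_sub_torusE_kerCov_le` + `|E_L[kerCov^{lift}]| ≤ V`). [folklore] -/
theorem femto_pair_bound (r : LatticeRep G) (β : ℝ) (x y : Fin 4 → ℤ) (R L : ℕ) (hRL : R + 2 ≤ L)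
    (hR : 1 ≤ R) (hyx : ∀ j, |y j - x j| + 1 ≤ (R : ℤ)) {hx hy V : ℝ}
    (hox : ∀ η η', |kerE G r β (fun j => x j - R) (2 * R + 1) η (dens G r x) -
      kerE G r β (fun j => x j - R) (2 * R + 1) η' (dens G r x)| ≤ hx)
    (hoy : ∀ η η', |kerE G r β (fun j => x j - R) (2 * R + 1) η (dens G r y) -
      kerE G r β (fun j => x j - R) (2 * R + 1) η' (dens G r y)| ≤ hy)
    (hV : ∀ η, |kerCov G r β (fun j => x j - R) (2 * R + 1) η (dens G r x) (dens G r y)| ≤ V) :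
    |torusE G r β L (fun U => dens G r x U * dens G r y U) -
        torusE G r β L (dens G r x) * torusE G r β L (dens G r y)| ≤ V + hx * hy := by
  haveI := r.secondCountableTopology
  haveI := isProbabilityMeasure_wilsonMeasure (d := 4) (L := 2 * L + 1) r.ρ r.continuous β
  obtain ⟨C, -, hC⟩ := StubLower.exists_abs_dens_le G r
  have hxx : ∀ j, |x j - x j| + 1 ≤ (R : ℤ) := fun j => by simp; exact_mod_cast hR
  have hL : 2 * R + 1 + 3 ≤ 2 * L + 1 := by omega
  have key := Summit.QuantumFields.YangMills.Cruxes.NT.Reference.abs_torusCov_sub_torusE_kerCov_le G r β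
    (fun j => x j - R) (2 * R + 1) L hL (continuous_dens r x) (continuous_dens r y) (hC x) (hC y)
    (StubLower.isCylinder_dens G r x) (StubLower.isCylinder_dens G r y)
    (fun e he j => by
      have h := StubLower.dens_supp_window G r x x R hxx e he j
      push_cast
      constructor <;> linarith [h.1, h.2])
    (fun e he j => by
      have h := StubLower.dens_supp_window G r x y R hyx e he j
      push_cast
      constructor <;> linarith [h.1, h.2])
    hox hoy
  have hmean : |torusE G r β L (fun ζ => kerCov G r β (fun j => x j - R) (2 * R + 1) ζ (dens G r x) (dens G r y))|
      ≤ V := by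
    unfold torusE
    exact abs_integral_le_of_abs_le (fun U => hV _)
  have tri := abs_sub_abs_le_abs_sub
    (torusE G r β L (fun U => dens G r x U * dens G r y U) - torusE G r β L (dens G r x) * torusE G r β L (dens G r y))
    (torusE G r β L (fun ζ => kerCov G r β (fun j => x j - R) (2 * R + 1) ζ (dens G r x) (dens G r y)))
  linarith

end Pair

/-! ## §3 The WINDOW at scale `1/u` from the femto conditional package in unit `u` -/
section Window

/-- **The asymptotic-freedom WINDOW from the femto conditional package (E1-osc ∧ CondCovAF in unit `u`).**  For a positive map
`u`, a physical collar `κ` and femto range `ℓ > 2κ`: (E1-osc) one-point exterior oscillation `≤ C₁/depth⁴` at physical depth `≥ κ` on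
femto cubes, and (CondCovAF) the conditional two-point amplitude `‖y−x‖⁸|kerCov^η(A_x,A_y)| ≤ W′` at physical separation `≤ s′(W′)`,
lattice separation `≥ n₀`, physical depth `≥ κ`, for every exterior — imply generation 2's WINDOW hypothesis (body verbatim) at the scale
`ℓ β = 1 / u β`: for every `W > 0` there are `T′ > 0, β₀` with `|Cov_{β,L}(A_x,A_y)| ≤ W (1+‖x−y‖)⁻⁸` whenever `T′‖x−y‖ ≤ 1/u β`,
`β ≥ β₀`, on all large tori.  Volume-free input, torus output: the torus enters only through the exact DLR equation
(`femto_pair_bound`).  [kernel reduction; both hypotheses OPEN] -/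
theorem covWindow_of_femtoAF (r : LatticeRep G) (u : ℝ → ℝ) (hu : ∀ β, 0 < u β)
    {κ ℓ C₁ : ℝ} (hκ : 0 < κ) (hκℓ : 2 * κ < ℓ) (hC₁ : 0 ≤ C₁)
    (hE1 : ∃ β₁ : ℝ, ∀ β : ℝ, β₁ ≤ β → ∀ (c : Fin 4 → ℤ) (b : ℕ), (b : ℝ) * u β ≤ ℓ →
      ∀ (η η' : LGConfig 4 G) (x : Fin 4 → ℤ), κ / u β ≤ (depth c b x : ℝ) →
        |kerE G r β c b η (dens G r x) - kerE G r β c b η' (dens G r x)| ≤ C₁ / (depth c b x : ℝ) ^ 4)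
    (hAF : ∃ n₀ : ℕ, ∀ W' : ℝ, 0 < W' → ∃ s' β' : ℝ, 0 < s' ∧ ∀ β : ℝ, β' ≤ β →
      ∀ (c : Fin 4 → ℤ) (b : ℕ), (b : ℝ) * u β ≤ ℓ → ∀ (η : LGConfig 4 G) (x y : Fin 4 → ℤ),
        (n₀ : ℝ) ≤ ‖siteToE (y - x)‖ → κ / u β ≤ (depth c b x : ℝ) → κ / u β ≤ (depth c b y : ℝ) →
          ‖siteToE (y - x)‖ * u β ≤ s' →
            ‖siteToE (y - x)‖ ^ 8 * |kerCov G r β c b η (dens G r x) (dens G r y)| ≤ W') :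
    ∀ W : ℝ, 0 < W → ∃ T' β₀ : ℝ, 0 < T' ∧ ∀ β : ℝ, β₀ ≤ β → ∀ᶠ L : ℕ in atTop,
      ∀ x ∈ box 4 L, ∀ y ∈ box 4 L, ‖x - y‖ ≤ (L : ℝ) → T' * ‖x - y‖ ≤ 1 / u β →
        |torusE G r β L (fun U => dens G r x U * dens G r y U) -
            torusE G r β L (dens G r x) * torusE G r β L (dens G r y)| ≤ W / (1 + ‖x - y‖) ^ 8 := by
  intro W hW
  obtain ⟨β₁, H1⟩ := hE1
  obtain ⟨n₀, hAF⟩ := hAF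
  -- the tree's volume-uniform weak-coupling bound (near pairs)
  obtain ⟨Wc, hWc0, hWc⟩ := exists_abs_torusCov_dens_le r
  -- the conditional AF clause at `W' = W / 2⁹`
  obtain ⟨s', β', hs', H2⟩ := hAF (W / 2 ^ 9) (by positivity)
  -- the boundary smallness parameter `εb ≤ 1`, `C₁² εb ≤ W/2`
  set εb : ℝ := min 1 (W / (2 * (C₁ ^ 2 + 1))) with hεb
  have hεb0 : 0 < εb := lt_min one_pos (by positivity)
  have hεb1 : εb ≤ 1 := min_le_left _ _
  have hεbW : εb ≤ W / (2 * (C₁ ^ 2 + 1)) := min_le_right _ _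
  have hℓκ : 0 < ℓ - 2 * κ := by linarith
  -- the window constant
  set T' : ℝ := max (max (2 / s') (9 / (ℓ - 2 * κ))) (2 / (κ * εb)) with hT'
  have hT's : 2 / s' ≤ T' := le_trans (le_max_left _ _) (le_max_left _ _)
  have hT'ℓ : 9 / (ℓ - 2 * κ) ≤ T' := le_trans (le_max_right _ _) (le_max_left _ _)
  have hT'κ : 2 / (κ * εb) ≤ T' := le_max_right _ _
  have hT'0 : 0 < T' := lt_of_lt_of_le (by positivity : (0 : ℝ) < 2 / s') hT's
  refine ⟨T', max (max β₁ β') (max 1 (4 * Wc * ((n₀ : ℝ) + 2) ^ 8 / W)), hT'0, fun β hβ => ?_⟩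
  have hβ₁ : β₁ ≤ β := le_trans (le_max_left _ _) (le_trans (le_max_left _ _) hβ)
  have hβ' : β' ≤ β := le_trans (le_max_right _ _) (le_trans (le_max_left _ _) hβ)
  have hβ1 : 1 ≤ β := le_trans (le_max_left _ _) (le_trans (le_max_right _ _) hβ)
  have hβW : 4 * Wc * ((n₀ : ℝ) + 2) ^ 8 / W ≤ β := le_trans (le_max_right _ _) (le_trans (le_max_right _ _) hβ)
  have hβ0 : 0 < β := lt_of_lt_of_le one_pos hβ1
  have huβ : 0 < u β := hu β
  refine (Filter.eventually_ge_atTop (max 1 (⌈κ / u β⌉₊ + ⌈1 / (T' * u β)⌉₊ + 3))).mono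
    fun L hL x _ y _ _ hwin => ?_
  have hL1 : 1 ≤ L := le_trans (le_max_left _ _) hL
  have hLR : ⌈κ / u β⌉₊ + ⌈1 / (T' * u β)⌉₊ + 3 ≤ L := le_trans (le_max_right _ _) hL
  set t : ℝ := ‖x - y‖ with ht
  have ht0 : 0 ≤ t := norm_nonneg _
  have hpos : 0 < (1 + t) ^ 8 := by positivity
  by_cases hnear : t < max (n₀ : ℝ) 1
  · -- NEAR pairs: `|Cov| ≤ Wc (1+log β)²/β² ≤ 4 Wc/β ≤ W/(n₀+2)⁸ ≤ W/(1+t)⁸`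
    have hcov := hWc L hL1 β hβ1 x y
    have hq : Wc * (1 + Real.log β) ^ 2 / β ^ 2 ≤ 4 * Wc / β := by
      rw [div_le_div_iff₀ (by positivity) hβ0]
      have hl := one_add_log_sq_le hβ1
      have h1 := mul_le_mul_of_nonneg_left hl hWc0
      have h2 := mul_le_mul_of_nonneg_right h1 hβ0.le
      calc Wc * (1 + Real.log β) ^ 2 * β ≤ Wc * (4 * β) * β := h2
        _ = 4 * Wc * β ^ 2 := by ring
    have hmax : max (n₀ : ℝ) 1 ≤ (n₀ : ℝ) + 1 := max_le (by linarith) (by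
      have := (Nat.cast_nonneg n₀ : (0 : ℝ) ≤ n₀); linarith)
    have h1 : (1 + t) ^ 8 ≤ ((n₀ : ℝ) + 2) ^ 8 := pow_le_pow_left₀ (by positivity) (by linarith) 8
    have hβW' : 4 * Wc / β ≤ W / ((n₀ : ℝ) + 2) ^ 8 := by
      rw [div_le_div_iff₀ hβ0 (by positivity)]
      have := (div_le_iff₀ hW).1 hβW
      linarith
    calc |torusE G r β L (fun U => dens G r x U * dens G r y U) -
            torusE G r β L (dens G r x) * torusE G r β L (dens G r y)|
        ≤ Wc * (1 + Real.log β) ^ 2 / β ^ 2 := hcov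
      _ ≤ 4 * Wc / β := hq
      _ ≤ W / ((n₀ : ℝ) + 2) ^ 8 := hβW'
      _ ≤ W / (1 + t) ^ 8 := div_le_div_of_nonneg_left hW.le hpos h1
  · -- FAR pairs: one femto cube around the pair
    rw [not_lt] at hnear
    have ht1 : 1 ≤ t := le_trans (le_max_right _ _) hnear
    have htn : (n₀ : ℝ) ≤ t := le_trans (le_max_left _ _) hnear
    -- Euclidean separation `E`, `t ≤ E ≤ 2t`
    set E : ℝ := ‖siteToE (y - x)‖ with hE
    have htE : t ≤ E := norm_sub_le_norm_siteToE_sub x y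
    have hEt : E ≤ 2 * t := norm_siteToE_sub_le_two_mul_norm_sub x y
    have hE1 : 1 ≤ E := ht1.trans htE
    have hE0 : 0 < E := lt_of_lt_of_le one_pos hE1
    -- units: `t · uβ ≤ 1/T'`, `uβ ≤ 1/T'`
    have hwin' : T' * t * u β ≤ 1 := by
      have h := hwin
      rw [le_div_iff₀ huβ] at h
      exact h
    have htu : t * u β ≤ 1 / T' := by
      rw [le_div_iff₀ hT'0]
      calc t * u β * T' = T' * t * u β := by ring
        _ ≤ 1 := hwin'
    have hu1 : u β ≤ 1 / T' := by
      refine le_trans ?_ htu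
      calc u β = 1 * u β := (one_mul _).symm
        _ ≤ t * u β := mul_le_mul_of_nonneg_right ht1 huβ.le
    -- the cube radius `R = ⌈κ/uβ⌉ + ⌈t⌉ + 1`
    set R : ℕ := ⌈κ / u β⌉₊ + ⌈t⌉₊ + 1 with hR
    have hR1 : 1 ≤ R := by omega
    have hκu : 0 < κ / u β := div_pos hκ huβ
    have hRge : κ / u β + t + 1 ≤ (R : ℝ) := by
      have h1 := Nat.le_ceil (κ / u β)
      have h2 := Nat.le_ceil t
      rw [hR]; push_cast; linarith
    have hRle : (R : ℝ) ≤ κ / u β + t + 3 := by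
      have h1 := (Nat.ceil_lt_add_one hκu.le).le
      have h2 := (Nat.ceil_lt_add_one ht0).le
      rw [hR]; push_cast; linarith
    -- torus fit `R + 2 ≤ L`
    have htT : t ≤ 1 / (T' * u β) := by
      rw [le_div_iff₀ (by positivity)]
      calc t * (T' * u β) = T' * t * u β := by ring
        _ ≤ 1 := hwin'
    have hRL : R + 2 ≤ L := by
      have : ⌈t⌉₊ ≤ ⌈1 / (T' * u β)⌉₊ := Nat.ceil_mono htT
      omega
    -- femto fit `(2R+1) · uβ ≤ 2κ + 9/T' ≤ ℓ`
    have h9 : 9 / T' ≤ ℓ - 2 * κ := by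
      rw [div_le_iff₀ hT'0]
      have h := hT'ℓ
      rw [div_le_iff₀ hℓκ] at h
      linarith
    have hfem : ((2 * R + 1 : ℕ) : ℝ) * u β ≤ ℓ := by
      push_cast
      have h1 : (2 * (R : ℝ) + 1) * u β ≤ 2 * κ + 2 * (t * u β) + 7 * u β := by
        have : (2 * (R : ℝ) + 1) * u β ≤ (2 * (κ / u β + t + 3) + 1) * u β :=
          mul_le_mul_of_nonneg_right (by linarith) huβ.le
        have e : (2 * (κ / u β + t + 3) + 1) * u β = 2 * κ + 2 * (t * u β) + 7 * u β := by
          field_simp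
          ring
        linarith
      have h2 : 2 * (t * u β) + 7 * u β ≤ 9 / T' := by
        have : 9 / T' = 2 * (1 / T') + 7 * (1 / T') := by ring
        rw [this]
        exact add_le_add (by linarith) (by linarith)
      linarith
    -- depths `≥ κ/uβ` at `x` and `y`
    have hdx : κ / u β ≤ (depth (fun j => x j - R) (2 * R + 1) x : ℝ) := by
      have h := StubLower.le_depth_cube x x R (t := 0) (fun j => by simp)
      linarith
    have hdy : κ / u β ≤ (depth (fun j => x j - R) (2 * R + 1) y : ℝ) := by
      have h := StubLower.le_depth_cube x y R (t := t) (fun j => abs_cast_sub_le_norm_sub x y j)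
      linarith
    -- the integer window `|y j − x j| + 1 ≤ R`
    have hyx : ∀ j, |y j - x j| + 1 ≤ (R : ℤ) := fun j => by
      have h1 : |((y j : ℤ) : ℝ) - x j| ≤ t := abs_cast_sub_le_norm_sub x y j
      have h2 : (((|y j - x j| : ℤ)) : ℝ) ≤ ((⌈t⌉₊ : ℕ) : ℝ) := by
        push_cast
        exact h1.trans (Nat.le_ceil t)
      have h3 : (|y j - x j| : ℤ) ≤ ((⌈t⌉₊ : ℕ) : ℤ) := by exact_mod_cast h2
      rw [hR]; push_cast; linarith
    -- E1-osc at the two sites: `h ≤ C₁ (uβ/κ)⁴`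
    have hdiv : ∀ d : ℝ, κ / u β ≤ d → C₁ / d ^ 4 ≤ C₁ * (u β / κ) ^ 4 := fun d hd => by
      have hd0 : 0 < d := lt_of_lt_of_le hκu hd
      rw [div_eq_mul_inv]
      refine mul_le_mul_of_nonneg_left ?_ hC₁
      rw [← inv_pow, show u β / κ = (κ / u β)⁻¹ by rw [inv_div]]
      exact pow_le_pow_left₀ (inv_nonneg.2 hd0.le) ((inv_le_inv₀ hd0 hκu).2 hd) 4
    have hosc : ∀ z : Fin 4 → ℤ, κ / u β ≤ (depth (fun j => x j - R) (2 * R + 1) z : ℝ) → ∀ η η' : LGConfig 4 G,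
        |kerE G r β (fun j => x j - R) (2 * R + 1) η (dens G r z) -
          kerE G r β (fun j => x j - R) (2 * R + 1) η' (dens G r z)| ≤ C₁ * (u β / κ) ^ 4 :=
      fun z hz η η' => (H1 β hβ₁ _ _ hfem η η' z hz).trans (hdiv _ hz)
    -- CondCovAF: `|kerCov^η| ≤ (W/2⁹)/E⁸` for every exterior
    have hsep : E * u β ≤ s' := by
      have h2T : 2 / T' ≤ s' := by
        rw [div_le_iff₀ hT'0]
        have h := hT's
        rw [div_le_iff₀ hs'] at h
        linarith
      calc E * u β ≤ 2 * t * u β := mul_le_mul_of_nonneg_right hEt huβ.le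
        _ = 2 * (t * u β) := by ring
        _ ≤ 2 * (1 / T') := by linarith
        _ = 2 / T' := by ring
        _ ≤ s' := h2T
    have hV : ∀ η : LGConfig 4 G,
        |kerCov G r β (fun j => x j - R) (2 * R + 1) η (dens G r x) (dens G r y)| ≤ (W / 2 ^ 9) / E ^ 8 := by
      intro η
      have h := H2 β hβ' _ _ hfem η x y (htn.trans htE) hdx hdy hsep
      rw [le_div_iff₀ (by positivity), mul_comm]
      exact h
    -- the per-pair bound
    have main := femto_pair_bound r β x y R L hRL hR1 hyx (hosc x hdx) (hosc y hdy) hV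
    -- numerics: the AF term
    have hAFterm : (W / 2 ^ 9) / E ^ 8 ≤ (W / 2) / (1 + t) ^ 8 := by
      rw [div_le_div_iff₀ (by positivity) hpos]
      have h2t : 1 + t ≤ 2 * E := by linarith
      have h8 : (1 + t) ^ 8 ≤ (2 * E) ^ 8 := pow_le_pow_left₀ (by positivity) h2t 8
      calc W / 2 ^ 9 * (1 + t) ^ 8 ≤ W / 2 ^ 9 * (2 * E) ^ 8 :=
            mul_le_mul_of_nonneg_left h8 (by positivity)
        _ = W / 2 * E ^ 8 := by ring
    -- numerics: the boundary term
    have hq2 : 2 / (T' * κ) ≤ εb := by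
      rw [div_le_iff₀ (by positivity)]
      have h := hT'κ
      rw [div_le_iff₀ (by positivity)] at h
      linarith
    set q : ℝ := u β * (1 + t) / κ with hq
    have hq0 : 0 ≤ q := by positivity
    have hq1 : q ≤ εb := by
      refine le_trans ?_ hq2
      rw [hq, div_le_div_iff₀ hκ (by positivity)]
      have : u β * (1 + t) ≤ 2 / T' := by
        calc u β * (1 + t) = u β + t * u β := by ring
          _ ≤ 1 / T' + 1 / T' := add_le_add hu1 htu
          _ = 2 / T' := by ring
      calc u β * (1 + t) * (T' * κ) = (u β * (1 + t)) * T' * κ := by ring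
        _ ≤ (2 / T') * T' * κ := by gcongr
        _ = 2 * κ := by field_simp
    have hq8 : q ^ 8 ≤ εb := (pow_le_pow_left₀ hq0 hq1 8).trans (pow_le_of_le_one hεb0.le hεb1 (by norm_num))
    have hBterm : C₁ * (u β / κ) ^ 4 * (C₁ * (u β / κ) ^ 4) ≤ (W / 2) / (1 + t) ^ 8 := by
      rw [le_div_iff₀ hpos]
      have e : C₁ * (u β / κ) ^ 4 * (C₁ * (u β / κ) ^ 4) * (1 + t) ^ 8 = C₁ ^ 2 * q ^ 8 := by
        rw [hq]; ring
      rw [e]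
      have hC2 : C₁ ^ 2 * εb ≤ W / 2 := by
        have h := mul_le_mul_of_nonneg_left hεbW (sq_nonneg C₁)
        have e2 : C₁ ^ 2 * (W / (2 * (C₁ ^ 2 + 1))) = (W / 2) * (C₁ ^ 2 / (C₁ ^ 2 + 1)) := by
          field_simp
        have h3 : C₁ ^ 2 / (C₁ ^ 2 + 1) ≤ 1 := by
          rw [div_le_one (by positivity)]; linarith
        calc C₁ ^ 2 * εb ≤ C₁ ^ 2 * (W / (2 * (C₁ ^ 2 + 1))) := h
          _ = (W / 2) * (C₁ ^ 2 / (C₁ ^ 2 + 1)) := e2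
          _ ≤ (W / 2) * 1 := mul_le_mul_of_nonneg_left h3 (by positivity)
          _ = W / 2 := mul_one _
      exact (mul_le_mul_of_nonneg_left hq8 (sq_nonneg C₁)).trans hC2
    have hsum : (W / 2) / (1 + t) ^ 8 + (W / 2) / (1 + t) ^ 8 = W / (1 + t) ^ 8 := by ring
    calc |torusE G r β L (fun U => dens G r x U * dens G r y U) -
            torusE G r β L (dens G r x) * torusE G r β L (dens G r y)|
        ≤ (W / 2 ^ 9) / E ^ 8 + C₁ * (u β / κ) ^ 4 * (C₁ * (u β / κ) ^ 4) := main
      _ ≤ (W / 2) / (1 + t) ^ 8 + (W / 2) / (1 + t) ^ 8 := add_le_add hAFterm hBterm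
      _ = W / (1 + t) ^ 8 := hsum

end Window


end Summit.QuantumFields.YangMills.Cruxes.IR.AfPincerUc

end
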